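import Summits.QuantumFields.BalabanUV.T4Continuum.Support.NE3QuadRemainderTower
import Summits.QuantumFields.BalabanUV.T4Continuum.Support.BlockAverageGaugeExtractCfg
import Summits.QuantumFields.BalabanUV.T4Continuum.Support.NE3NestedBlockMeanCovariance
import Summits.QuantumFields.BalabanUV.T4Continuum.Support.NE3EnergyVary
import HarnessLib

/-!
# T⁴ programme, node NE3 — route Π, item Π-C-3γ′ (ruling ρ-g26-1 (2), design D-ne3leaf02g8-1 §2), file γ23:
# THE ONE-STEP RELATIVE COORDINATE OF A FIELD WITH A GAUGE COMPONENT — `relStep L V (gaugeDir V Λ + R)` is, EXACTLY, the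
# three-factor logarithm `log(e^{Ad Λ_c(y)}·e^{relStep L V R′}·e^{−Λ_c(y+e_κ)})` of the coarse charges `Λ_c = Λ ∘ (L•)` around the
# relative coordinate of the EXTRACTED field `R′ = gaugeExtract V Λ R`, and it differs from `gaugeDir (cavg L V) Λ_c + relStep L V R′`
# by an ENDS-FORM error (products of two DIFFERENT factors among the two end charges and `relStep R′` — no `‖Λ‖²` self-term)

NE3 (node U1b) formalisation swarm `b2b-balaban-t4-ne3-formalise-*`, LEAF PROVER 02 (gen 8; Π-C authors' lineage).  WHY (D-ne3r2-g12-1 ∕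
D-ne3leaf02g8-1 §1): the residual slice representative of a minimiser pair carries a lattice-Coulomb GAUGE spike at every top corner, present
in the level-j relative field at EVERY level j through the frame potential; any one-step remainder bound QUADRATIC in a local size of the
field pays the spike's square once per level (a formal `k`-dependence of `C₂`).  The cure is to carry the gauge component EXACTLY through the
averaging step: by this lineage's configuration identity `BlockAverageGaugeExtractCfg.vary_gaugeDir_add_eq_gaugeAct` (over leaf-10's one-bond
extraction `BlockAverageGaugeExtract`) `V·e^{gaugeDir V Λ + R} = (V·e^{R′})^{e^{Λ}}`, by NE3-R2's covariance `cavg_gaugeAct` the average of a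
gauge transform is the gauge transform by the subsampled gauge, and by Π-C-2's consistency `vary_cavg_relStep` the average of `V·e^{R′}` is
`V̄·e^{relStep R′}` — so the spike never enters a square: only products of a charge with the OTHER end's charge (zero for lacunary charges)
or with `relStep R′` appear.

CONTENT (0 sorry, 0 def): §1 ENDS-FORM BCH LETTERS — `norm_mlog_exp_mul_exp_sub_le` (`‖log(e^{A}e^{B}) − (A+B)‖ ≤ 4096‖A‖‖B‖`, from
leaf-10's `logK` letter and its mirror under inversion), `norm_mlog_exp3_sub_le` (`‖log(e^{a}e^{ρ}e^{−b}) − (a+ρ−b)‖ ≤ 10240(‖a‖‖ρ‖+‖a‖‖b‖+‖ρ‖‖b‖)`);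
§2 **`relStep_gaugeDir_add`** (the exact three-factor form); §3 **`norm_relStep_gaugeDir_add_sub_le`** (the ends-form bound) and
**`norm_quadRem_gaugeDir_add_sub_le`**: with K1 (`cpush_gaugeDir`) and `cpush_add`, the one-step QUADRATIC REMAINDER `relStep − cpush` of
`gaugeDir V Λ + R` equals that of `R′` plus the push of the extraction defect `R′ − R` up to the same ends-form error.

HONEST FRAMING.  Kinematics of ONE averaging step on OUR objects (unitary periodic small-field `V`, skew periodic charges and remainder in
displayed balls); nothing multiscale yet (the k-fold induction γ4′∕γ5′ of D-ne3leaf02g8-1 is OPEN), nothing about Bałaban's minimisers;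
Π-C-3γ′, (Π-REG-γ′), T-E_w♯ and NE3 are NOT proved; spine PROVED 0∕9; finite T⁴ rung (B)+1 — NOT infinite volume, NOT mass gap, NOT `BetaPertH`,
NOT Clay.  PLACEMENT: `Summits/QuantumFields/BalabanUV/`.  HONEST DEPENDENCY: continuum YM on T⁴ ⇐ BetaPertH ∧ nine spine estimates (0/9
proved); BetaPertH ⇐ (D1) ∧ (D4) ∧ CAP+tail; G-an2-4 gates asym, D1 and NE2/3/4.
-/

set_option autoImplicit false

open scoped BigOperators Matrix.Norms.L2Operator
open NormedSpace Finset

namespace Summit.QuantumFields.BalabanUV.T4Continuum.NE3QuadRemainderGaugeStep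

open Literature.MathematicalPhysics.QuantumFieldTheory.Balaban1983to89
open B7Prop1Explicit B7Prop2Explicit MatrixLog
open T4AveragingDeficitWall (IsSkewDir IsUnitaryCfg SmallField vary Ad)
open T4AveragingDeficitWallBoundary (IsPeriodicCfg)
open AveragingDeficitChartCalculus (cavg)
open AveragingDeficitMultiLevelPrep (cpush)
open AveragingDeficitTransport (norm_Ad_of_unitary Ad_mem_skewAdjoint)
open AveragingDeficitLocality (expUnit_Ad)
open AveragingDeficitPlaqDeriv (vary_isUnitaryCfg)
open AveragingDeficitTwoLevelPrep (cavg_isUnitaryCfg)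
open BlockAverageVaryDisc (rho0)
open BlockAveragePushDirGauge (gaugeDir expGauge)
open BlockAverageLogInteraction (logK norm_logK_one_one_le norm_exp_sub_one_le_two_mul)
open BlockAverageGaugeExtract (gaugeExtract)
open BlockAverageGaugeExtractCfg (vary_gaugeDir_add_eq_gaugeAct isSkewDir_gaugeExtract)
open NE3NestedBlockMeanCovariance (cavg_gaugeAct)
open NE3EnergyVary (smallField_vary_linear)
open NE3TangentCovariantStructure (cpush_add cpush_gaugeDir)
open NE3QuadRemainderTower (relStep vary_cavg_relStep)

noncomputable section

variable {d : ℕ} {n : Type*} [Fintype n] [DecidableEq n] [Nonempty n]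

/-! ## §1 Ends-form BCH letters -/

omit [Fintype n] [DecidableEq n] [Nonempty n] in
/-- `log(e^{A}e^{B}) − (A+B) = K(B, A+B)(1,1)` (leaf-10's second logarithm). [folklore] -/
theorem mlog_exp_mul_exp_eq_add_logK [Fintype n] [DecidableEq n] (A B : Matrix n n ℂ) :
    mlog (exp A * exp B) = (A + B) + logK B (A + B) 1 1 := by
  simp only [logK, one_smul, add_sub_cancel_right]
  abel

/-- `‖e^{A}e^{B} − 1‖ ≤ 3∕32` for `‖A‖, ‖B‖ ≤ 1∕64`. [folklore] -/
theorem norm_exp_mul_exp_sub_one_le_small {A B : Matrix n n ℂ} (hA : ‖A‖ ≤ 1 / 64) (hB : ‖B‖ ≤ 1 / 64) :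
    ‖exp A * exp B - 1‖ ≤ 3 / 32 := by
  obtain ⟨hA1, -⟩ := norm_exp_sub_one_le_two_mul hA (by norm_num)
  obtain ⟨hB1, hB2⟩ := norm_exp_sub_one_le_two_mul hB (by norm_num)
  have h : exp A * exp B - 1 = (exp A - 1) * exp B + (exp B - 1) := by noncomm_ring
  rw [h]
  calc ‖(exp A - 1) * exp B + (exp B - 1)‖ ≤ ‖exp A - 1‖ * ‖exp B‖ + ‖exp B - 1‖ :=
        (norm_add_le _ _).trans (add_le_add (norm_mul_le _ _) le_rfl)
    _ ≤ 2 * (1 / 64) * (1 + 2 * (1 / 64)) + 2 * (1 / 64) := by gcongr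
    _ ≤ 3 / 32 := by norm_num

/-- THE MIRROR: `log(e^{−B}e^{−A}) = −log(e^{A}e^{B})` for `‖A‖, ‖B‖ ≤ 1∕64` (the product is a unit within `3∕32` of `1`; `log u⁻¹ = −log u` via
`exp(−log u) = u⁻¹` and `log ∘ exp = id` on `‖·‖ < log 2`). [folklore] -/
theorem mlog_exp_neg_mul_exp_neg {A B : Matrix n n ℂ} (hA : ‖A‖ ≤ 1 / 64) (hB : ‖B‖ ≤ 1 / 64) :
    mlog (exp (-B) * exp (-A)) = -mlog (exp A * exp B) := by
  letI : NormedAlgebra ℚ (Matrix n n ℂ) := NormedAlgebra.restrictScalars ℚ ℝ (Matrix n n ℂ)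
  have hP := norm_exp_mul_exp_sub_one_le_small hA hB
  set Y := mlog (exp A * exp B) with hY
  have hYn : ‖Y‖ ≤ 3 / 16 := (norm_mlog_le_two_mul (hP.trans (by norm_num))).trans (by linarith)
  have hexp : exp Y = exp A * exp B := exp_mlog (hP.trans_lt (by norm_num))
  have hinv : exp (-B) * exp (-A) = exp (-Y) := by
    have h1 : exp (-Y) * exp Y = 1 := by
      rw [← exp_add_of_commute (Commute.refl Y).neg_left, neg_add_cancel, exp_zero]
    have hA' : exp A * exp (-A) = 1 := by
      rw [← exp_add_of_commute (Commute.refl A).neg_right, add_neg_cancel, exp_zero]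
    have hB' : exp B * exp (-B) = 1 := by
      rw [← exp_add_of_commute (Commute.refl B).neg_right, add_neg_cancel, exp_zero]
    rw [hexp] at h1
    -- `e^{−Y} = e^{−Y}·(e^{A}e^{B})·(e^{−B}e^{−A}) = e^{−B}e^{−A}`
    calc exp (-B) * exp (-A) = (exp (-Y) * (exp A * exp B)) * (exp (-B) * exp (-A)) := by rw [h1, one_mul]
      _ = exp (-Y) * (exp A * (exp B * exp (-B)) * exp (-A)) := by noncomm_ring
      _ = exp (-Y) := by rw [hB', mul_one, hA', mul_one]
  rw [hinv]
  refine B7BlockAvgLog.mlog_exp ?_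
  rw [norm_neg]
  linarith [Real.log_two_gt_d9]

/-- **TWO FACTORS, ENDS FORM**: `‖log(e^{A}e^{B}) − (A + B)‖ ≤ 4096·‖A‖·‖B‖` for `‖A‖, ‖B‖ ≤ 1∕100` — leaf-10's `K`-letter gives `2048·‖B‖·‖A+B‖`, its
mirror under inversion gives `2048·‖A‖·‖A+B‖`, and `min(‖A‖,‖B‖)·(‖A‖+‖B‖) ≤ 2‖A‖‖B‖`. [folklore] -/
theorem norm_mlog_exp_mul_exp_sub_le {A B : Matrix n n ℂ} (hA : ‖A‖ ≤ 1 / 100) (hB : ‖B‖ ≤ 1 / 100) :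
    ‖mlog (exp A * exp B) - (A + B)‖ ≤ 4096 * ‖A‖ * ‖B‖ := by
  have hAB : ‖A + B‖ < 1 / 32 := (norm_add_le _ _).trans_lt (by linarith)
  have hA0 := norm_nonneg A
  have hB0 := norm_nonneg B
  have hA64 : ‖A‖ ≤ 1 / 64 := hA.trans (by norm_num)
  have hB64 : ‖B‖ ≤ 1 / 64 := hB.trans (by norm_num)
  -- direct form
  have h1 : ‖mlog (exp A * exp B) - (A + B)‖ ≤ 2048 * ‖B‖ * ‖A + B‖ := by
    rw [mlog_exp_mul_exp_eq_add_logK, add_sub_cancel_left]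
    have h := norm_logK_one_one_le (b := B) (R := A + B) (by linarith) hAB
    have e : 2 * (‖B‖ / (1 / 32)) * (‖A + B‖ / (1 / 32)) = 2048 * ‖B‖ * ‖A + B‖ := by ring
    linarith
  -- mirrored form
  have h2 : ‖mlog (exp A * exp B) - (A + B)‖ ≤ 2048 * ‖A‖ * ‖A + B‖ := by
    have hnA : ‖-A‖ ≤ 1 / 64 := by rwa [norm_neg]
    have hnB : ‖-B‖ ≤ 1 / 64 := by rwa [norm_neg]
    have hBA : ‖-B + -A‖ < 1 / 32 := by rw [← neg_add, norm_neg, add_comm]; exact hAB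
    have hm := mlog_exp_neg_mul_exp_neg hA64 hB64
    have h := norm_logK_one_one_le (b := -A) (R := -B + -A) (by rw [norm_neg]; linarith) hBA
    have hk : mlog (exp (-B) * exp (-A)) = (-B + -A) + logK (-A) (-B + -A) 1 1 := mlog_exp_mul_exp_eq_add_logK (-B) (-A)
    have hid : mlog (exp A * exp B) - (A + B) = -logK (-A) (-B + -A) 1 1 := by
      have : mlog (exp A * exp B) = -((-B + -A) + logK (-A) (-B + -A) 1 1) := by rw [← hk, hm, neg_neg]
      rw [this]; abel
    rw [hid, norm_neg]
    have e : 2 * (‖-A‖ / (1 / 32)) * (‖-B + -A‖ / (1 / 32)) = 2048 * ‖A‖ * ‖A + B‖ := by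
      rw [norm_neg, ← neg_add, norm_neg, add_comm]; ring
    linarith
  -- combine: min(a,b)(a+b) ≤ 2ab
  have hs : ‖A + B‖ ≤ ‖A‖ + ‖B‖ := norm_add_le _ _
  rcases le_total ‖A‖ ‖B‖ with hle | hle
  · calc ‖mlog (exp A * exp B) - (A + B)‖ ≤ 2048 * ‖A‖ * ‖A + B‖ := h2
      _ ≤ 2048 * ‖A‖ * (‖A‖ + ‖B‖) := by gcongr
      _ ≤ 4096 * ‖A‖ * ‖B‖ := by nlinarith
  · calc ‖mlog (exp A * exp B) - (A + B)‖ ≤ 2048 * ‖B‖ * ‖A + B‖ := h1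
      _ ≤ 2048 * ‖B‖ * (‖A‖ + ‖B‖) := by gcongr
      _ ≤ 4096 * ‖A‖ * ‖B‖ := by nlinarith

/-- **THREE FACTORS, ENDS FORM**: for `‖a‖, ‖ρ‖, ‖b‖ ≤ 1∕8192`,
`‖log(e^{a}·e^{ρ}·e^{−b}) − (a + ρ − b)‖ ≤ 10240·(‖a‖‖ρ‖ + ‖a‖‖b‖ + ‖ρ‖‖b‖)` — every term carries two DIFFERENT factors; in particular the bound
vanishes for `ρ = 0`, `b = 0` (an isolated charge) and has NO `‖a‖²`, `‖b‖²`. [folklore] -/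
theorem norm_mlog_exp3_sub_le {a ρ b : Matrix n n ℂ} (ha : ‖a‖ ≤ 1 / 8192) (hρ : ‖ρ‖ ≤ 1 / 8192) (hb : ‖b‖ ≤ 1 / 8192) :
    ‖mlog (exp a * exp ρ * exp (-b)) - (a + ρ - b)‖ ≤ 10240 * (‖a‖ * ‖ρ‖ + ‖a‖ * ‖b‖ + ‖ρ‖ * ‖b‖) := by
  have ha0 := norm_nonneg a
  have hρ0 := norm_nonneg ρ
  have hb0 := norm_nonneg b
  have hnb : ‖-b‖ ≤ 1 / 8192 := by rwa [norm_neg]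
  -- the inner pair `P′ := log(e^{ρ}e^{−b})`
  set P' := mlog (exp ρ * exp (-b)) with hP'
  have hin : ‖P' - (ρ + -b)‖ ≤ 4096 * ‖ρ‖ * ‖-b‖ := norm_mlog_exp_mul_exp_sub_le (hρ.trans (by norm_num)) (hnb.trans (by norm_num))
  rw [norm_neg] at hin
  have hprod : ‖ρ‖ * ‖b‖ ≤ 1 / 8192 * ‖b‖ := mul_le_mul_of_nonneg_right hρ hb0
  have hP'n : ‖P'‖ ≤ 2 * (‖ρ‖ + ‖b‖) := by
    have h1 : ‖P'‖ ≤ ‖P' - (ρ + -b)‖ + ‖ρ + -b‖ := norm_le_norm_sub_add _ _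
    have h2 : ‖ρ + -b‖ ≤ ‖ρ‖ + ‖b‖ := (norm_add_le _ _).trans (by rw [norm_neg])
    nlinarith
  have hP's : ‖P'‖ ≤ 1 / 100 := hP'n.trans (by linarith)
  -- `e^{P′} = e^{ρ}e^{−b}`
  have hball : ‖exp ρ * exp (-b) - 1‖ < 1 := (norm_exp_mul_exp_sub_one_le_small (hρ.trans (by norm_num)) (hnb.trans (by norm_num))).trans_lt
    (by norm_num)
  have hexpP : exp P' = exp ρ * exp (-b) := exp_mlog hball
  have hassoc : exp a * exp ρ * exp (-b) = exp a * exp P' := by rw [hexpP, mul_assoc]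
  -- the outer pair
  have hout : ‖mlog (exp a * exp P') - (a + P')‖ ≤ 4096 * ‖a‖ * ‖P'‖ := norm_mlog_exp_mul_exp_sub_le (ha.trans (by norm_num)) hP's
  rw [hassoc]
  have hsplit : mlog (exp a * exp P') - (a + ρ - b) = (mlog (exp a * exp P') - (a + P')) + (P' - (ρ + -b)) := by abel
  rw [hsplit]
  calc ‖(mlog (exp a * exp P') - (a + P')) + (P' - (ρ + -b))‖
      ≤ 4096 * ‖a‖ * ‖P'‖ + 4096 * ‖ρ‖ * ‖b‖ := (norm_add_le _ _).trans (add_le_add hout hin)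
    _ ≤ 4096 * ‖a‖ * (2 * (‖ρ‖ + ‖b‖)) + 4096 * ‖ρ‖ * ‖b‖ := by gcongr
    _ ≤ 10240 * (‖a‖ * ‖ρ‖ + ‖a‖ * ‖b‖ + ‖ρ‖ * ‖b‖) := by nlinarith [mul_nonneg ha0 hρ0, mul_nonneg ha0 hb0, mul_nonneg hρ0 hb0]

/-! ## §2 The exact three-factor form of the one-step relative coordinate -/

omit [Nonempty n] in
/-- `e^{λ(x)}` is unitary for skew `λ(x)`. [folklore] -/
theorem expGauge_one_mem_unitaryUnits {Λ : Site d → Matrix n n ℂ} (hΛ : ∀ x, Λ x ∈ skewAdjoint (Matrix n n ℂ)) (x : Site d) :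
    expGauge Λ 1 x ∈ unitaryUnits (Matrix n n ℂ) := by
  letI : NormedAlgebra ℚ (Matrix n n ℂ) := NormedAlgebra.restrictScalars ℚ ℝ (Matrix n n ℂ)
  rw [mem_unitaryUnits]
  simp only [expGauge, val_expUnit, Complex.ofReal_one, one_smul]
  exact NormedSpace.exp_mem_unitary_of_mem_skewAdjoint (hΛ x)

/-- **THE ONE-STEP RELATIVE COORDINATE OF A FIELD WITH A GAUGE COMPONENT, EXACTLY.**  For `L ≥ 1`, a unitary background `V` of plaquette radius
`a`, skew charges `Λ` below `1∕64`, a skew remainder `R` below `1∕64`, the extracted field `R′ := gaugeExtract V Λ R` with sup `≤ r ≤ min(1, rho0∕4)` and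
the enlarged class line `512(d+1)(d+4)L²·(a + 8r) ≤ 1` (so that `V·e^{R′}` is still in the class): at every coarse bond,
`relStep L V (gaugeDir V Λ + R) y κ = log( e^{Ad_{V̄(y,κ)⁻¹} Λ(L•y)} · e^{relStep L V R′ y κ} · e^{−Λ(L•(y+e_κ))} )`, `V̄ = cavg L V`. [folklore] -/
theorem relStep_gaugeDir_add {L : ℕ} (hL : 1 ≤ L) {V : Site d → Fin d → (Matrix n n ℂ)ˣ} (hVu : IsUnitaryCfg V)
    {a : ℝ} (ha : 0 ≤ a) (hVa : SmallField V a) {Λ : Site d → Matrix n n ℂ} (hΛ : ∀ x, Λ x ∈ skewAdjoint (Matrix n n ℂ))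
    (hΛs : ∀ x, ‖Λ x‖ < 1 / 64) {R : Site d → Fin d → Matrix n n ℂ} (hR : IsSkewDir R) (hRs : ∀ x μ, ‖R x μ‖ < 1 / 64)
    {r : ℝ} (hr : ∀ x μ, ‖gaugeExtract V Λ R x μ‖ ≤ r) (hr1 : r ≤ 1) (hrρ : r ≤ rho0 d L / 4)
    (hsmall : 512 * (d + 1) * (d + 4) * (L : ℝ) ^ 2 * (a + 8 * r) ≤ 1) (y : Site d) (κ : Fin d) :
    relStep L V (gaugeDir V Λ + R) y κ
      = mlog (exp (Ad (cavg L V y κ)⁻¹ (Λ ((L : ℤ) • y))) * exp (relStep L V (gaugeExtract V Λ R) y κ)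
          * exp (-(Λ ((L : ℤ) • (y + e κ))))) := by
  have hr0 : 0 ≤ r := (norm_nonneg _).trans (hr y κ)
  have hsmall0 : 512 * (d + 1) * (d + 4) * (L : ℝ) ^ 2 * a ≤ 1 := by
    have : 512 * (d + 1) * (d + 4) * (L : ℝ) ^ 2 * a ≤ 512 * (d + 1) * (d + 4) * (L : ℝ) ^ 2 * (a + 8 * r) :=
      mul_le_mul_of_nonneg_left (by linarith) (by positivity)
    exact this.trans hsmall
  -- the varied configuration along the extracted field is unitary and in the enlarged class
  set R' := gaugeExtract V Λ R with hR'def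
  have hR's : IsSkewDir R' := isSkewDir_gaugeExtract hVu hΛ hR hΛs hRs
  have hZu : IsUnitaryCfg (vary V R' 1) := vary_isUnitaryCfg hVu hR's 1
  have hZa : SmallField (vary V R' 1) (a + 8 * r) := smallField_vary_linear hVu hVa hR's hr0 hr1 hr
  have haZ : 0 ≤ a + 8 * r := by positivity
  have hu : ∀ x, expGauge Λ 1 x ∈ unitaryUnits (Matrix n n ℂ) := expGauge_one_mem_unitaryUnits hΛ
  -- (1) extraction, (2) covariance, (3) consistency
  have h1 : vary V (gaugeDir V Λ + R) 1 = gaugeAct (expGauge Λ 1) (vary V R' 1) := vary_gaugeDir_add_eq_gaugeAct hVu Λ R hΛs hRs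
  have h2 : cavg L (gaugeAct (expGauge Λ 1) (vary V R' 1)) = gaugeAct (fun w => expGauge Λ 1 ((L : ℤ) • w)) (cavg L (vary V R' 1)) :=
    cavg_gaugeAct hL hZu haZ hsmall hZa hu
  have h3 : cavg L (vary V R' 1) = vary (cavg L V) (relStep L V R') 1 := (vary_cavg_relStep hL hVu ha hsmall0 hVa hr hrρ).symm
  -- assemble at the bond (unfold only the OUTER relative coordinate)
  have hdef : relStep L V (gaugeDir V Λ + R) y κ
      = mlog ((((cavg L V y κ)⁻¹ : (Matrix n n ℂ)ˣ) : Matrix n n ℂ) * ((cavg L (vary V (gaugeDir V Λ + R) 1) y κ : (Matrix n n ℂ)ˣ) : Matrix n n ℂ)) :=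
    rfl
  rw [hdef, h1, h2, h3]
  simp only [gaugeAct, vary, expGauge, Units.val_mul, val_expUnit, val_inv_expUnit, Complex.ofReal_one, one_smul]
  have hAd : exp (Ad (cavg L V y κ)⁻¹ (Λ ((L : ℤ) • y)))
      = (((cavg L V y κ)⁻¹ : (Matrix n n ℂ)ˣ) : Matrix n n ℂ) * exp (Λ ((L : ℤ) • y)) * ((cavg L V y κ : (Matrix n n ℂ)ˣ) : Matrix n n ℂ) := by
    have h := congrArg Units.val (expUnit_Ad (cavg L V y κ)⁻¹ (Λ ((L : ℤ) • y)))
    simpa only [val_expUnit, Units.val_mul, inv_inv] using h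
  rw [hAd]
  simp only [mul_assoc]

/-! ## §3 The ends-form bounds -/

/-- **THE ONE-STEP RELATIVE COORDINATE SPLITS UP TO AN ENDS-FORM ERROR**: in the setting of `relStep_gaugeDir_add`, with the charges and
`relStep L V R′` below `1∕8192`,
`‖relStep L V (gaugeDir V Λ + R) y κ − (gaugeDir (cavg L V) (Λ∘(L•)) y κ + relStep L V R′ y κ)‖ ≤ 10240·(ℓ₋·ρ + ℓ₋·ℓ₊ + ρ·ℓ₊)`,
`ℓ₋ = ‖Λ(L•y)‖`, `ℓ₊ = ‖Λ(L•(y+e_κ))‖`, `ρ = ‖relStep L V R′ y κ‖` — for LACUNARY coarse charges `ℓ₋·ℓ₊ = 0` and only charge × `relStep R′` remains. [folklore] -/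
theorem norm_relStep_gaugeDir_add_sub_le {L : ℕ} (hL : 1 ≤ L) {V : Site d → Fin d → (Matrix n n ℂ)ˣ} (hVu : IsUnitaryCfg V)
    {a : ℝ} (ha : 0 ≤ a) (hVa : SmallField V a) {Λ : Site d → Matrix n n ℂ} (hΛ : ∀ x, Λ x ∈ skewAdjoint (Matrix n n ℂ))
    (hΛs : ∀ x, ‖Λ x‖ ≤ 1 / 8192) {R : Site d → Fin d → Matrix n n ℂ} (hR : IsSkewDir R) (hRs : ∀ x μ, ‖R x μ‖ < 1 / 64)
    {r : ℝ} (hr : ∀ x μ, ‖gaugeExtract V Λ R x μ‖ ≤ r) (hr1 : r ≤ 1) (hrρ : r ≤ rho0 d L / 4)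
    (hsmall : 512 * (d + 1) * (d + 4) * (L : ℝ) ^ 2 * (a + 8 * r) ≤ 1) (y : Site d) (κ : Fin d)
    (hρ : ‖relStep L V (gaugeExtract V Λ R) y κ‖ ≤ 1 / 8192) :
    ‖relStep L V (gaugeDir V Λ + R) y κ
        - (gaugeDir (cavg L V) (fun w => Λ ((L : ℤ) • w)) y κ + relStep L V (gaugeExtract V Λ R) y κ)‖
      ≤ 10240 * (‖Λ ((L : ℤ) • y)‖ * ‖relStep L V (gaugeExtract V Λ R) y κ‖
          + ‖Λ ((L : ℤ) • y)‖ * ‖Λ ((L : ℤ) • (y + e κ))‖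
          + ‖relStep L V (gaugeExtract V Λ R) y κ‖ * ‖Λ ((L : ℤ) • (y + e κ))‖) := by
  have hΛs' : ∀ x, ‖Λ x‖ < 1 / 64 := fun x => (hΛs x).trans_lt (by norm_num)
  have hsmall0 : 512 * (d + 1) * (d + 4) * (L : ℝ) ^ 2 * a ≤ 1 := by
    have hr0 : 0 ≤ r := (norm_nonneg _).trans (hr y κ)
    have : 512 * (d + 1) * (d + 4) * (L : ℝ) ^ 2 * a ≤ 512 * (d + 1) * (d + 4) * (L : ℝ) ^ 2 * (a + 8 * r) :=
      mul_le_mul_of_nonneg_left (by linarith) (by positivity)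
    exact this.trans hsmall
  rw [relStep_gaugeDir_add hL hVu ha hVa hΛ hΛs' hR hRs hr hr1 hrρ hsmall y κ]
  have hVbar : cavg L V y κ ∈ unitaryUnits (Matrix n n ℂ) := cavg_isUnitaryCfg hL hVu ha hsmall0 hVa y κ
  have hna : ‖Ad (cavg L V y κ)⁻¹ (Λ ((L : ℤ) • y))‖ = ‖Λ ((L : ℤ) • y)‖ := norm_Ad_of_unitary ((unitaryUnits _).inv_mem hVbar) _
  have h := norm_mlog_exp3_sub_le (a := Ad (cavg L V y κ)⁻¹ (Λ ((L : ℤ) • y))) (ρ := relStep L V (gaugeExtract V Λ R) y κ)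
    (b := Λ ((L : ℤ) • (y + e κ))) (by rw [hna]; exact hΛs _) hρ (hΛs _)
  rw [hna] at h
  have hid : Ad (cavg L V y κ)⁻¹ (Λ ((L : ℤ) • y)) + relStep L V (gaugeExtract V Λ R) y κ - Λ ((L : ℤ) • (y + e κ))
      = gaugeDir (cavg L V) (fun w => Λ ((L : ℤ) • w)) y κ + relStep L V (gaugeExtract V Λ R) y κ := by
    simp only [gaugeDir]; abel
  rw [hid] at h
  exact h

/-- **THE ONE-STEP QUADRATIC REMAINDER OF A FIELD WITH A GAUGE COMPONENT** (periodic data, so that K1 applies): with `X := gaugeDir V Λ + R`,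
`R′ := gaugeExtract V Λ R`, the remainder `relStep L V X − cpush L V X` equals the remainder of `R′` plus the push of the extraction defect
`R′ − R`, up to the ends-form error of `norm_relStep_gaugeDir_add_sub_le`:
`‖(relStep X − cpush X) − (relStep R′ − cpush R′) − cpush (R′ − R)‖(y,κ) ≤ 10240·(ℓ₋ρ + ℓ₋ℓ₊ + ρℓ₊)`. [folklore] -/
theorem norm_quadRem_gaugeDir_add_sub_le {L M : ℕ} [NeZero M] [NeZero (L * M)] (hL : 1 ≤ L) {V : Site d → Fin d → (Matrix n n ℂ)ˣ}
    (hVu : IsUnitaryCfg V) (hVP : IsPeriodicCfg V ((L * M : ℕ) : ℤ)) {a : ℝ} (ha : 0 ≤ a) (hVa : SmallField V a)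
    {Λ : Site d → Matrix n n ℂ} (hΛ : ∀ x, Λ x ∈ skewAdjoint (Matrix n n ℂ)) (hΛs : ∀ x, ‖Λ x‖ ≤ 1 / 8192)
    (hΛP : ∀ (x : Site d) (i : Fin d), Λ (x + ((L * M : ℕ) : ℤ) • e i) = Λ x)
    {R : Site d → Fin d → Matrix n n ℂ} (hR : IsSkewDir R) (hRs : ∀ x μ, ‖R x μ‖ < 1 / 64)
    {r : ℝ} (hr : ∀ x μ, ‖gaugeExtract V Λ R x μ‖ ≤ r) (hr1 : r ≤ 1) (hrρ : r ≤ rho0 d L / 4)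
    (hsmall : 512 * (d + 1) * (d + 4) * (L : ℝ) ^ 2 * (a + 8 * r) ≤ 1) (y : Site d) (κ : Fin d)
    (hρ : ‖relStep L V (gaugeExtract V Λ R) y κ‖ ≤ 1 / 8192) :
    ‖(relStep L V (gaugeDir V Λ + R) y κ - cpush L V (gaugeDir V Λ + R) y κ)
        - (relStep L V (gaugeExtract V Λ R) y κ - cpush L V (gaugeExtract V Λ R) y κ)
        - cpush L V (fun x μ => gaugeExtract V Λ R x μ - R x μ) y κ‖
      ≤ 10240 * (‖Λ ((L : ℤ) • y)‖ * ‖relStep L V (gaugeExtract V Λ R) y κ‖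
          + ‖Λ ((L : ℤ) • y)‖ * ‖Λ ((L : ℤ) • (y + e κ))‖
          + ‖relStep L V (gaugeExtract V Λ R) y κ‖ * ‖Λ ((L : ℤ) • (y + e κ))‖) := by
  have hsmall0 : 512 * (d + 1) * (d + 4) * (L : ℝ) ^ 2 * a ≤ 1 := by
    have hr0 : 0 ≤ r := (norm_nonneg _).trans (hr y κ)
    have : 512 * (d + 1) * (d + 4) * (L : ℝ) ^ 2 * a ≤ 512 * (d + 1) * (d + 4) * (L : ℝ) ^ 2 * (a + 8 * r) :=
      mul_le_mul_of_nonneg_left (by linarith) (by positivity)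
    exact this.trans hsmall
  -- the push of `X` splits: K1 on the gauge part, additivity on the rest
  have hX : (gaugeDir V Λ + R) = fun x μ => gaugeDir V Λ x μ + R x μ := rfl
  have hpushX : cpush L V (gaugeDir V Λ + R) y κ = gaugeDir (cavg L V) (fun w => Λ ((L : ℤ) • w)) y κ + cpush L V R y κ := by
    rw [hX, cpush_add hL hVu ha hsmall0 hVa]
    rw [cpush_gaugeDir (M := M) hL hVu hVP ha hsmall0 hVa hΛ hΛP]
  -- the push of `R′` splits as `R + (R′ − R)`
  have hR'eq : gaugeExtract V Λ R = fun x μ => R x μ + (gaugeExtract V Λ R x μ - R x μ) := by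
    funext x μ; abel
  have hpushR' : cpush L V (gaugeExtract V Λ R) y κ
      = cpush L V R y κ + cpush L V (fun x μ => gaugeExtract V Λ R x μ - R x μ) y κ := by
    conv_lhs => rw [hR'eq]
    rw [cpush_add hL hVu ha hsmall0 hVa]
  have h := norm_relStep_gaugeDir_add_sub_le hL hVu ha hVa hΛ hΛs hR hRs hr hr1 hrρ hsmall y κ hρ
  have hid : (relStep L V (gaugeDir V Λ + R) y κ - cpush L V (gaugeDir V Λ + R) y κ)
        - (relStep L V (gaugeExtract V Λ R) y κ - cpush L V (gaugeExtract V Λ R) y κ)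
        - cpush L V (fun x μ => gaugeExtract V Λ R x μ - R x μ) y κ
      = relStep L V (gaugeDir V Λ + R) y κ
        - (gaugeDir (cavg L V) (fun w => Λ ((L : ℤ) • w)) y κ + relStep L V (gaugeExtract V Λ R) y κ) := by
    rw [hpushX, hpushR']; abel
  rw [hid]
  exact h

end

end Summit.QuantumFields.BalabanUV.T4Continuum.NE3QuadRemainderGaugeStep
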